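import Summits.AtomisticToContinuum.HydrodynamicLimit.Theses.ImplosionDichotomy
import Summits.AtomisticToContinuum.HydrodynamicLimit.Theorems.DenseExcursion.Negative.Untied

/-!
# The positivity clauses of `DenseExcursion` are load-bearing: at `a₀ ≡ 0` or `θ₀ ≡ 0` the tie is vacuous

Negative knowledge for the crux `ImplosionDichotomy.DenseExcursion` (stmt-AtomisticToContinuum-12586), from the
standing disprover's `Cruxes/DenseExcursion/Disproof.lean` §6. `DenseExcursionNonnegActivity` /
`DenseExcursionNonnegTemperature` are the crux VERBATIM with `∀ x, 0 < a₀ x` (resp. `∀ x, 0 < θ₀ x`) weakened to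
`≤`, and both HOLD for a degenerate reason: at `a₀ ≡ 0` (resp. `θ₀ ≡ 0`, where the local Maxwellian takes the junk
value `(2π·0)^(-3/2) = 0`) the one-particle profile vanishes, the canonical density is `0⁻¹ · 0 = 0`, every local
Gibbs law is the ZERO measure, the `t = 0` tie holds for ANY fields, and the constant state of density `σ⁻³` is an
admissible classical witness of packing `1`. Hence a disproof of the crux (= a proof of `DiluteSelfConsistency`)
must use BOTH strict positivity clauses — they are exactly what makes the tie pin the data.
refuter-cdisprove-stmt-AtomisticToContinuum-12586-g2-0.
-/

noncomputable section

namespace Summit.AtomisticToContinuum.HydrodynamicLimit.Theorems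

open MeasureTheory Filter Set Topology
open Literature.MathematicalPhysics.KineticTheory Literature.Analysis.FluidPDE

/-- The crux `DenseExcursion` with `a₀ > 0` WEAKENED to `a₀ ≥ 0` (all else verbatim). -/
def DenseExcursionNonnegActivity : Prop :=
  ∃ η : ℝ, 0 < η ∧ ∃ (a₀ θ₀ : Literature.MathematicalPhysics.KineticTheory.T3 → ℝ) (u₀ : Literature.MathematicalPhysics.KineticTheory.T3 → Literature.MathematicalPhysics.KineticTheory.V3), Continuous a₀ ∧ Continuous θ₀ ∧ Continuous u₀ ∧ (∀ x, 0 ≤ a₀ x) ∧ (∀ x, 0 < θ₀ x) ∧ ∀ σ₀ : ℝ, 0 < σ₀ → ∃ σ : ℝ, 0 < σ ∧ σ < σ₀ ∧ ∃ (T : ℝ) (ρ θ : ℝ → Literature.MathematicalPhysics.KineticTheory.T3 → ℝ) (u : ℝ → Literature.MathematicalPhysics.KineticTheory.T3 → Literature.MathematicalPhysics.KineticTheory.V3), Literature.MathematicalPhysics.KineticTheory.IsHardSphereEulerSolution σ T ρ u θ ∧ (∀ Φ : (N : ℕ) → Literature.Analysis.FluidPDE.HardSphereFlow (Literature.Analysis.FluidPDE.Torus.geometry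 (Fin 3)) (Literature.MathematicalPhysics.KineticTheory.hsDiameter σ N) (N + 1), Literature.MathematicalPhysics.KineticTheory.TendstoHydroFieldsAt (fun N => Literature.MathematicalPhysics.KineticTheory.localGibbsLaw σ a₀ u₀ θ₀ N (Φ N)) Φ ρ u θ 0) ∧ ∃ t ∈ Set.Ico 0 T, ∃ x, η ≤ ρ t x * σ ^ 3

/-- The crux `DenseExcursion` with `θ₀ > 0` WEAKENED to `θ₀ ≥ 0` (all else verbatim). -/
def DenseExcursionNonnegTemperature : Prop :=
  ∃ η : ℝ, 0 < η ∧ ∃ (a₀ θ₀ : Literature.MathematicalPhysics.KineticTheory.T3 → ℝ) (u₀ : Literature.MathematicalPhysics.KineticTheory.T3 → Literature.MathematicalPhysics.KineticTheory.V3), Continuous a₀ ∧ Continuous θ₀ ∧ Continuous u₀ ∧ (∀ x, 0 < a₀ x) ∧ (∀ x, 0 ≤ θ₀ x) ∧ ∀ σ₀ : ℝ, 0 < σ₀ → ∃ σ : ℝ, 0 < σ ∧ σ < σ₀ ∧ ∃ (T : ℝ) (ρ θ : ℝ → Literature.MathematicalPhysics.KineticTheory.T3 → ℝ) (u : ℝ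 → Literature.MathematicalPhysics.KineticTheory.T3 → Literature.MathematicalPhysics.KineticTheory.V3), Literature.MathematicalPhysics.KineticTheory.IsHardSphereEulerSolution σ T ρ u θ ∧ (∀ Φ : (N : ℕ) → Literature.Analysis.FluidPDE.HardSphereFlow (Literature.Analysis.FluidPDE.Torus.geometry (Fin 3)) (Literature.MathematicalPhysics.KineticTheory.hsDiameter σ N) (N + 1), Literature.MathematicalPhysics.KineticTheory.TendstoHydroFieldsAt (fun N => Literature.MathematicalPhysics.KineticTheory.localGibbsLaw σ a₀ u₀ θ₀ N (Φ N)) Φ ρ u θ 0) ∧ ∃ t ∈ Set.Ico 0 T, ∃ x, η ≤ ρ t x * σ ^ 3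

namespace DenseExcursionDegenerate

/-- If the one-particle profile vanishes identically, the local Gibbs law is the ZERO measure. [folklore] -/
theorem localGibbsLaw_eq_zero_of_profile {σ : ℝ} {a₀ θ₀ : T3 → ℝ} {u₀ : T3 → V3}
    (h : ∀ y, localGibbsProfile a₀ u₀ θ₀ y = 0) (N : ℕ)
    (Φ : HardSphereFlow (Torus.geometry (Fin 3)) (hsDiameter σ N) (N + 1)) :
    localGibbsLaw σ a₀ u₀ θ₀ N Φ = 0 := by
  have hprof : localGibbsProfile a₀ u₀ θ₀ = 0 := funext h
  rw [localGibbsLaw, particleLaw_eq, hprof]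
  have hdens : (fun z : Config (N + 1) (Fin 3) T3 => ENNReal.ofReal
      (canonicalDensity (Torus.geometry (Fin 3)) (hsDiameter σ N) (N + 1) 0 z)) = 0 := by
    funext z
    simp [canonicalDensity, tensorPow, Set.indicator]
  rw [hdens]
  exact withDensity_zero

/-- A vanishing profile makes EVERY field family tied at `t = 0` (all deviation probabilities are `0`). [folklore] -/
theorem tendsto_of_profile_zero {σ : ℝ} {a₀ θ₀ : T3 → ℝ} {u₀ : T3 → V3}
    (h : ∀ y, localGibbsProfile a₀ u₀ θ₀ y = 0) (ρ θ : ℝ → T3 → ℝ) (u : ℝ → T3 → V3)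
    (Φ : (N : ℕ) → HardSphereFlow (Torus.geometry (Fin 3)) (hsDiameter σ N) (N + 1)) :
    TendstoHydroFieldsAt (fun N => localGibbsLaw σ a₀ u₀ θ₀ N (Φ N)) Φ ρ u θ 0 := by
  intro χ _ δ _
  have h0 : ∀ (N : ℕ) (A : Set (Config (N + 1) (Fin 3) T3)), localGibbsLaw σ a₀ u₀ θ₀ N (Φ N) A = 0 :=
    fun N A => by rw [localGibbsLaw_eq_zero_of_profile h N (Φ N)]; rfl
  simp only [h0]
  exact ⟨tendsto_const_nhds, tendsto_const_nhds, tendsto_const_nhds⟩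

end DenseExcursionDegenerate

open DenseExcursionDegenerate DenseExcursionUntied

/-- `a₀ > 0` IS LOAD-BEARING: with `a₀ ≡ 0` allowed, the constant state of density `(σ₀/2)⁻³` at `σ = σ₀/2` is an
admissible witness (the laws vanish, the tie is vacuous). [folklore] -/
theorem denseExcursionNonnegActivity_holds : DenseExcursionNonnegActivity := by
  refine ⟨1, one_pos, fun _ => 0, fun _ => 1, fun _ => 0, continuous_const, continuous_const,
    continuous_const, fun _ => le_rfl, fun _ => one_pos, fun σ₀ hσ₀ => ?_⟩
  have hσ : 0 < σ₀ / 2 := by positivity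
  have hprof : ∀ y, localGibbsProfile (fun _ : T3 => (0 : ℝ)) (fun _ => (0 : V3)) (fun _ => 1) y = 0 :=
    fun y => by simp [localGibbsProfile]
  refine ⟨σ₀ / 2, hσ, by linarith, 1, fun _ _ => ((σ₀ / 2) ^ 3)⁻¹, fun _ _ => 1, fun _ _ => 0,
    isHardSphereEulerSolution_const _ 1 0 (inv_pos.2 (pow_pos hσ 3)) one_pos,
    tendsto_of_profile_zero hprof _ _ _, 0, ⟨le_rfl, one_pos⟩, 0, ?_⟩
  rw [inv_mul_cancel₀ (pow_pos hσ 3).ne']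

/-- `θ₀ > 0` IS LOAD-BEARING: at `θ₀ ≡ 0` the local Maxwellian is the junk value `0`, the laws vanish and the same
constant state is an admissible witness. [folklore] -/
theorem denseExcursionNonnegTemperature_holds : DenseExcursionNonnegTemperature := by
  refine ⟨1, one_pos, fun _ => 1, fun _ => 0, fun _ => 0, continuous_const, continuous_const,
    continuous_const, fun _ => one_pos, fun _ => le_rfl, fun σ₀ hσ₀ => ?_⟩
  have hσ : 0 < σ₀ / 2 := by positivity
  have hprof : ∀ y, localGibbsProfile (fun _ : T3 => (1 : ℝ)) (fun _ => (0 : V3)) (fun _ => 0) y = 0 := by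
    intro y
    have hfin : (Module.finrank ℝ V3 : ℝ) = 3 := by simp
    simp only [localGibbsProfile, localMaxwellian, hfin, mul_zero, one_mul]
    rw [Real.zero_rpow (by norm_num)]
    simp
  refine ⟨σ₀ / 2, hσ, by linarith, 1, fun _ _ => ((σ₀ / 2) ^ 3)⁻¹, fun _ _ => 1, fun _ _ => 0,
    isHardSphereEulerSolution_const _ 1 0 (inv_pos.2 (pow_pos hσ 3)) one_pos,
    tendsto_of_profile_zero hprof _ _ _, 0, ⟨le_rfl, one_pos⟩, 0, ?_⟩
  rw [inv_mul_cancel₀ (pow_pos hσ 3).ne']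

end Summit.AtomisticToContinuum.HydrodynamicLimit.Theorems

end
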